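import Summits.QuantumFields.BalabanUV.Beta.GAN24.StaircaseLaplacianDefect
import Literature.MathematicalPhysics.QuantumFieldTheory.Balaban1983to89.B5G183FreeRowSum

/-!
# G-an2-4 ∕ (CONV-C), road P2, route R2-S1, VECTOR LAYER — THE LAPLACIAN BRICK: Bałaban's componentwise vector Laplacian
# `Δ = Σ_ν ∇_ν*∇_ν` (`B5Prop11Lower.Lap`) against the componentwise staircase `(J⊗1)u = u ∘ (par × id)`, EXACTLY, by slicing to
# `StaircaseLaplacianDefect.LapS_stair_defect`

Unit `b2b-balaban-gan24-p2` (gen 29), BINDER row G-an2-4 ∕ (CONV-C), road P2.  At `U = 1` the vector operators of [B5] act componentwise: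
`(∇_ν u)_μ(x) = n(u_μ(x + e_ν) − u_μ(x))` (`B5Prop11Plancherel.fdiff`, pv15's `B5G183FreeRowSum.fdiff_mulVec`), `Δ = Σ_ν ∇_ν*∇_ν`
(`B5Prop11Lower.Lap`).  So every vector two-level identity about `Δ` is the scalar one on the slice `u_μ = fun y ↦ u (y, μ)`:
 * §1 slicing lemmas `fdiff_mulVec_slice`, `fdiffH_mulVec_slice`, `fdiffH_fdiff_mulVec_slice`, **`Lap_mulVec_slice`**
   (`(Δu)(x, μ) = (LapS u_μ)(x)`);
 * §2 **`Lap_stairV_defect`** — for every vector field `u` on the `η`-lattice and every fine bond `(x′, μ)` of the `η∕R`-lattice,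
   `(Δ′((J⊗1)u))(x′, μ) − (Δu)(par x′, μ) = (Σ_ν ∂′_νᴴ(∂′_νᴴ(π^L_ν·J(∂_νu_μ)) + π^F_ν·J(∂_νᴴ∂_νu_μ)))(x′)` — the scalar
   `LapS_stair_defect` on the slice, written with `(J⊗1)u := fun i ↦ u (par i.1, i.2)` (no new definition).
Together with `StaircaseLineSumDefect.QvAdj_succ_sub_stair` (the mass term's adjoint side) and the NE2 lane's
`LineAveragingPairing.sqrt_smul_QvOp_mul_JK` (its forward side), this is the two-level census of `Δ + aQ*Q` at `U = 1`; the `∂P∂*` term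
of Bałaban's `Δ_a` (1.69) is NOT treated here (road P2's successor reads it through lit-balaban's `B5Eq181GTorus.eq182`).
HONEST SCOPE.  Exact finite-lattice algebra, every `d`, `N, R ≥ 1`, every torus; [folklore], kernel-checked, no `sorry`, no `def`; nothing of
Bałaban's asserted ([Balaban1984PropagatorsI] (1.21)∕(1.31) are TEXT LOCATIONS).  NOT (CONV-C), NEVER «G-an2-4 closed», NOT NE2, NOT D1, NOT
BetaPertH, NOT continuum, NOT Clay; not in print — our bookkeeping.  HONEST DEPENDENCY: continuum YM on T⁴ ⇐ BetaPertH ∧ nine spine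
estimates (0/9 proved); BetaPertH ⇐ (D1) ∧ (D4) ∧ CAP+tail; G-an2-4 gates asym, D1 and NE2/3/4.
-/

noncomputable section

open scoped BigOperators ComplexConjugate Matrix

namespace Summit.QuantumFields.BalabanUV.Beta.GAN24.StaircaseLaplacianDefectVec

open Literature.MathematicalPhysics.QuantumFieldTheory.Balaban1983to89
open B5Prop11Plancherel (Tor fine unitVec fdiff)
open B5Prop11Lower (Lap)
open B5Action121 (sdiff LapS sdiff_mulVec sdiff_conjTranspose_mulVec)
open B5G183FreeRowSum (fdiff_mulVec fdiff_conjTranspose_mulVec)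
open Summit.QuantumFields.BalabanUV.T4Continuum.BalabanAveragedTowerModes (par)
open Summit.QuantumFields.BalabanUV.Beta.GAN24.StaircaseLaplacianDefect (stair stair_mulVec piL piF LapS_stair_defect)

variable {d : ℕ}

/-! ## §1 Slicing the componentwise vector operators -/

section Slice

variable {Nf : Fin d → ℕ} [∀ μ, NeZero (Nf μ)]

/-- `(∇_ν u)(x, μ) = (∂_ν u_μ)(x)` with `u_μ = fun y ↦ u (y, μ)`. [folklore] -/
theorem fdiff_mulVec_slice (c : ℂ) (ν : Fin d) (u : Tor Nf × Fin d → ℂ) (x : Tor Nf) (μ : Fin d) :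
    (fdiff Nf c ν *ᵥ u) (x, μ) = (sdiff Nf c ν *ᵥ fun y => u (y, μ)) x := by
  rw [fdiff_mulVec, sdiff_mulVec]

/-- `(∇_ν* u)(x, μ) = (∂_ν* u_μ)(x)`. [folklore] -/
theorem fdiffH_mulVec_slice (c : ℂ) (ν : Fin d) (u : Tor Nf × Fin d → ℂ) (x : Tor Nf) (μ : Fin d) :
    ((fdiff Nf c ν)ᴴ *ᵥ u) (x, μ) = ((sdiff Nf c ν)ᴴ *ᵥ fun y => u (y, μ)) x := by
  rw [fdiff_conjTranspose_mulVec, sdiff_conjTranspose_mulVec]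

/-- the slice of `∇_ν u` is `∂_ν` of the slice (as functions). [folklore] -/
theorem slice_fdiff_mulVec (c : ℂ) (ν : Fin d) (u : Tor Nf × Fin d → ℂ) (μ : Fin d) :
    (fun y => (fdiff Nf c ν *ᵥ u) (y, μ)) = sdiff Nf c ν *ᵥ fun y => u (y, μ) :=
  funext fun x => fdiff_mulVec_slice c ν u x μ

/-- `(∇_ν*∇_ν u)(x, μ) = (∂_ν*∂_ν u_μ)(x)`. [folklore] -/
theorem fdiffH_fdiff_mulVec_slice (c : ℂ) (ν : Fin d) (u : Tor Nf × Fin d → ℂ) (x : Tor Nf) (μ : Fin d) :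
    ((fdiff Nf c ν)ᴴ *ᵥ (fdiff Nf c ν *ᵥ u)) (x, μ) = ((sdiff Nf c ν)ᴴ *ᵥ (sdiff Nf c ν *ᵥ fun y => u (y, μ))) x := by
  rw [fdiffH_mulVec_slice, slice_fdiff_mulVec]

end Slice

section OneLevel

variable (n : ℕ) [NeZero n] (M : Fin d → ℕ) [hM : ∀ μ, NeZero (M μ)]

/-- **`(Δu)(x, μ) = (LapS u_μ)(x)`**: the vector Laplacian `Σ_ν ∇_ν*∇_ν` acts as the scalar one on each component. [folklore] -/
theorem Lap_mulVec_slice (u : Tor (fine n M) × Fin d → ℂ) (x : Tor (fine n M)) (μ : Fin d) :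
    (Lap n M *ᵥ u) (x, μ) = (LapS (fine n M) (n : ℂ) *ᵥ fun y => u (y, μ)) x := by
  rw [Lap, LapS, Matrix.sum_mulVec, Matrix.sum_mulVec, Finset.sum_apply, Finset.sum_apply]
  refine Finset.sum_congr rfl fun ν _ => ?_
  rw [← Matrix.mulVec_mulVec, ← Matrix.mulVec_mulVec, fdiffH_fdiff_mulVec_slice]

end OneLevel

/-! ## §2 The vector Laplacian against the componentwise staircase -/

section TwoLevel

variable (N R : ℕ) [NeZero N] [NeZero R] (M : Fin d → ℕ) [hM : ∀ μ, NeZero (M μ)]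

omit [NeZero R] in
/-- the slice of `(J⊗1)u` is `J` of the slice. [folklore] -/
theorem slice_stairV (u : Tor (fine N M) × Fin d → ℂ) (μ : Fin d) :
    (fun y : Tor (fine (R * N) M) => u (par N R M y, μ)) = stair N R M *ᵥ fun y => u (y, μ) :=
  funext fun y => by rw [stair_mulVec]

/-- **THE VECTOR LAPLACIAN AGAINST THE COMPONENTWISE STAIRCASE, EXACTLY**: with `(J⊗1)u := fun i ↦ u (par i.1, i.2)`,
`(Δ′((J⊗1)u))(x′, μ) − (Δu)(par x′, μ) = (Σ_ν ∂′_νᴴ( ∂′_νᴴ(π^L_ν·J(∂_ν u_μ)) + π^F_ν·J(∂_νᴴ∂_ν u_μ) ))(x′)` — the scalar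
`StaircaseLaplacianDefect.LapS_stair_defect` on the slice `u_μ`; sources of size `≤ (R−1)∕(RN) < η` in divergence form. [folklore] -/
theorem Lap_stairV_defect (u : Tor (fine N M) × Fin d → ℂ) (x : Tor (fine (R * N) M)) (μ : Fin d) :
    (Lap (R * N) M *ᵥ fun i : Tor (fine (R * N) M) × Fin d => u (par N R M i.1, i.2)) (x, μ) - (Lap N M *ᵥ u) (par N R M x, μ)
      = (∑ ν, (sdiff (fine (R * N) M) ((R * N : ℕ) : ℂ) ν)ᴴ *ᵥ
          (((sdiff (fine (R * N) M) ((R * N : ℕ) : ℂ) ν)ᴴ *ᵥ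
              (fun z => piL N R M ν z * (stair N R M *ᵥ (sdiff (fine N M) ((N : ℕ) : ℂ) ν *ᵥ fun y => u (y, μ))) z))
            + (fun z => piF N R M ν z * (stair N R M *ᵥ ((sdiff (fine N M) ((N : ℕ) : ℂ) ν)ᴴ *ᵥ
                (sdiff (fine N M) ((N : ℕ) : ℂ) ν *ᵥ fun y => u (y, μ)))) z))) x := by
  have h := congrFun (LapS_stair_defect N R M (fun y => u (y, μ))) x
  rw [Pi.sub_apply] at h
  rw [Lap_mulVec_slice, Lap_mulVec_slice, slice_stairV, ← stair_mulVec N R M (LapS (fine N M) ((N : ℕ) : ℂ) *ᵥ fun y => u (y, μ)) x]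
  push_cast at h ⊢
  exact h

end TwoLevel

end Summit.QuantumFields.BalabanUV.Beta.GAN24.StaircaseLaplacianDefectVec

end
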